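import Mathlib.MeasureTheory.Integral.Lebesgue.Countable
import Mathlib.MeasureTheory.Integral.Bochner.Basic
import Mathlib.Topology.Algebra.InfiniteSum.ENNReal
import Literature.NumberTheory.LFunctions.WeilCriterionConverseDirichlet
import Literature.NumberTheory.LFunctions.WeilExplicitDirichletProofs
import Literature.NumberTheory.LFunctions.WeilExplicitProofs
import HarnessLib

/-!
# The zero-height measure of `L(s, χ)` and the Bochner form of Weil's criterion for `GRH(χ)`

Topic `Literature/NumberTheory/LFunctions` (normalisation of `WeilExplicitDirichlet.lean`: tests
`IsWeilTest`, transform `ĝ = weilMellin g`, twisted functional `W_χ = weilFunctionalChar χ`,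
`Q_χ(g) = W_χ(g ⋆ g̃) = weilQuadraticChar χ g`; non-trivial zeros `ExplicitPsiChar.charNontrivialZeros χ`
with multiplicity `DirichletDisc.zeroOrder χ`; `GRH(χ) = DirichletCharacter.RiemannHypothesis χ`).
The `χ`-twisted twin of `WeilBochnerRepresentationRH.lean` (`ζ`), for `χ` primitive mod `q ≠ 1`:

* `charZeroHeightMeasure χ = Σ_ρ m_χ(ρ)·δ_{Im ρ}` (sum over the non-trivial zeros of `L(s, χ)`);
* `weilQuadraticChar_eq_integral_of_riemannHypothesis`: under `GRH(χ)`,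
  `W_χ(g ⋆ g̃) = ∫ ‖ĝ(½+it)‖² dν_χ(t)` for every test `g` (Weil's (11), `explicit_formula_dirichlet_holds`,
  with `(g ⋆ g̃)^(ρ) = ‖ĝ(ρ)‖²` on the line);
* `riemannHypothesis_iff_exists_measure_char`: **`GRH(χ) ↔ ∃ μ, ∀ g test, Re W_χ(g ⋆ g̃) = ∫ ‖ĝ(½+it)‖² dμ`**
  (`←` by Weil's criterion on `C_c^∞`, `weil_criterion_dirichlet_of_explicitFormula`).

So each rung `WeilPositivityOnChar χ t` of the GRH arm is, like the `ζ`-rungs, one window of a moment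
problem for a positive measure on the critical line.  Everything here is PROVED; one definition.

## References
* A. Weil, *Sur les "formules explicites" de la théorie des nombres premiers* (1952), (11) and the
  «lemme» p. 262 [cite: Weil1952FormulesExplicites].
-/

noncomputable section

open Complex Filter Set MeasureTheory
open scoped Real Topology ENNReal ComplexConjugate

namespace Literature.NumberTheory.LFunctions

namespace WeilBochner

open ExplicitPsiChar

variable {q : ℕ} [NeZero q] {χ : DirichletCharacter ℂ q} {g : ℝ → ℂ}

/-- **The height measure of the non-trivial zeros of `L(s, χ)`**: `ν_χ = Σ_ρ m_χ(ρ)·δ_{Im ρ}` on `ℝ`,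
the sum over `charNontrivialZeros χ` (each zero once) of the Dirac mass at `Im ρ` weighted by the
multiplicity `DirichletDisc.zeroOrder χ ρ` — the zero side of Weil's (11) seen on the critical line.
[cite: Weil1952FormulesExplicites, (11) pp. 261–262 (zero side)] -/
def charZeroHeightMeasure (χ : DirichletCharacter ℂ q) : Measure ℝ :=
  Measure.sum fun ρ : charNontrivialZeros χ ↦
    ((DirichletDisc.zeroOrder χ (ρ : ℂ) : ℕ) : ℝ≥0∞) • Measure.dirac (ρ : ℂ).im

/-- `∫ f dν_χ = Σ_ρ m_χ(ρ) f(Im ρ)` for measurable `f ≥ 0`.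
[cite: Weil1952FormulesExplicites, (11) pp. 261–262 (zero side)] -/
theorem lintegral_charZeroHeightMeasure (χ : DirichletCharacter ℂ q) {f : ℝ → ℝ≥0∞} (hf : Measurable f) :
    ∫⁻ t, f t ∂charZeroHeightMeasure χ =
      ∑' ρ : charNontrivialZeros χ, ((DirichletDisc.zeroOrder χ (ρ : ℂ) : ℕ) : ℝ≥0∞) * f (ρ : ℂ).im := by
  rw [charZeroHeightMeasure, lintegral_sum_measure]
  refine tsum_congr fun ρ ↦ ?_
  rw [lintegral_smul_measure, lintegral_dirac' _ hf, smul_eq_mul]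

/-- Under `GRH(χ)` a non-trivial zero is `ρ = ½ + i·Im ρ`. [folklore] -/
private theorem eq_half_add_im_of_grh (hGRH : χ.RiemannHypothesis) {ρ : ℂ}
    (hρ : ρ ∈ charNontrivialZeros χ) : ρ = 1 / 2 + (ρ.im : ℂ) * I := by
  obtain ⟨hL, h0, h1⟩ := hρ
  have hre : ρ.re = 1 / 2 := hGRH ρ hL h0 h1
  apply Complex.ext
  · simp [hre]
  · simp

/-- **Weil's form for `L(s, χ)` as an integral against the zero-height measure, under `GRH(χ)`**
(`χ` primitive mod `q ≠ 1`): for every test `g`, `‖ĝ(½+it)‖² ∈ L¹(ν_χ)` and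
`W_χ(g ⋆ g̃) = ∫ ‖ĝ(½+it)‖² dν_χ(t) = Σ_ρ m_χ(ρ)‖ĝ(ρ)‖²` — Weil's (11) for `g ⋆ g̃`
(`explicit_formula_dirichlet_holds`, absolutely convergent zero side `summable_norm_zeroSideChar`) with
`(g ⋆ g̃)^(ρ) = ‖ĝ(ρ)‖²` on the critical line.
[cite: Weil1952FormulesExplicites, (11) pp. 261–262 and p. 262 («il faut»)] -/
theorem weilQuadraticChar_eq_integral_of_riemannHypothesis (hq : q ≠ 1) (hprim : χ.IsPrimitive)
    (hGRH : χ.RiemannHypothesis) (hg : IsWeilTest g) :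
    Integrable (fun t : ℝ ↦ ‖weilMellin g (1 / 2 + t * I)‖ ^ 2) (charZeroHeightMeasure χ) ∧
      weilQuadraticChar χ g =
        ((∫ t, ‖weilMellin g (1 / 2 + t * I)‖ ^ 2 ∂charZeroHeightMeasure χ : ℝ) : ℂ) := by
  have hq1 : 1 < q := lt_of_le_of_ne NeZero.one_le (Ne.symm hq)
  have hχ : χ ≠ 1 := by
    rintro rfl
    rw [DirichletCharacter.isPrimitive_def, DirichletCharacter.conductor_one] at hprim
    exact hq hprim.symm
  set F : ℝ → ℝ := fun t ↦ ‖weilMellin g (1 / 2 + t * I)‖ ^ 2 with hF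
  have hFc : Continuous F := by
    have h1 : Continuous fun t : ℝ ↦ (1 / 2 : ℂ) + t * I := by fun_prop
    exact ((continuous_weilMellin hg.1.continuous hg.2).comp h1).norm.pow 2
  have hF0 : ∀ t, 0 ≤ F t := fun t ↦ by positivity
  -- the square and its zero side
  set k := weilConv g (weilReflect g) with hk_def
  have hk : IsWeilTest k := hg.weilConv hg.weilReflect
  have hsum := WeilExplicitDirichletProofs.summable_norm_zeroSideChar hprim hq1 hk
  have hWZ : weilFunctionalChar χ k =
      ∑' ρ : charNontrivialZeros χ, (DirichletDisc.zeroOrder χ (ρ : ℂ) : ℂ) * weilMellin k ρ :=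
    tendsto_nhds_unique (explicit_formula_dirichlet_holds χ hq hprim hk)
      (WeilConverseChar.hasWeilZeroSideChar_tsum hχ hsum)
  -- termwise under GRH
  set m : charNontrivialZeros χ → ℕ := fun ρ ↦ DirichletDisc.zeroOrder χ (ρ : ℂ) with hm
  have hterm : ∀ ρ : charNontrivialZeros χ,
      (DirichletDisc.zeroOrder χ (ρ : ℂ) : ℂ) * weilMellin k ρ = (((m ρ : ℝ) * F (ρ : ℂ).im : ℝ) : ℂ) := by
    intro ρ
    have e := congrArg (weilMellin k) (eq_half_add_im_of_grh hGRH ρ.2)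
    rw [e, hk_def, weilMellin_weilConv_weilReflect_half hg]
    simp only [hF, hm]
    push_cast
    ring
  have hterm0 : ∀ ρ : charNontrivialZeros χ, 0 ≤ (m ρ : ℝ) * F (ρ : ℂ).im := fun ρ ↦
    mul_nonneg (Nat.cast_nonneg _) (hF0 _)
  have hsumR : Summable fun ρ : charNontrivialZeros χ ↦ (m ρ : ℝ) * F (ρ : ℂ).im :=
    hsum.congr fun ρ ↦ by
      rw [hterm, Complex.norm_real, Real.norm_eq_abs, abs_of_nonneg (hterm0 ρ)]
  set S : ℝ := ∑' ρ : charNontrivialZeros χ, (m ρ : ℝ) * F (ρ : ℂ).im with hS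
  have hS0 : 0 ≤ S := tsum_nonneg hterm0
  have hWS : weilFunctionalChar χ k = (S : ℂ) := by
    rw [hWZ, hS, Complex.ofReal_tsum]
    exact tsum_congr hterm
  -- the integral against `ν_χ`
  have hlint : ∫⁻ t, ENNReal.ofReal (F t) ∂charZeroHeightMeasure χ = ENNReal.ofReal S := by
    rw [lintegral_charZeroHeightMeasure χ hFc.measurable.ennreal_ofReal, hS,
      ENNReal.ofReal_tsum_of_nonneg hterm0 hsumR]
    refine tsum_congr fun ρ ↦ ?_
    rw [ENNReal.ofReal_mul (Nat.cast_nonneg _), ENNReal.ofReal_natCast]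
  have hint : Integrable F (charZeroHeightMeasure χ) :=
    ⟨hFc.aestronglyMeasurable,
      (hasFiniteIntegral_iff_ofReal (ae_of_all _ hF0)).2 (by rw [hlint]; exact ENNReal.ofReal_lt_top)⟩
  have hI : ∫ t, F t ∂charZeroHeightMeasure χ = S := by
    rw [integral_eq_lintegral_of_nonneg_ae (ae_of_all _ hF0) hFc.aestronglyMeasurable, hlint,
      ENNReal.toReal_ofReal hS0]
  refine ⟨hint, ?_⟩
  show weilFunctionalChar χ (weilConv g (weilReflect g)) = _
  rw [← hk_def, hWS, hI]

/-- **`GRH(χ)` ⟺ Weil's twisted form is represented by a positive measure on the critical line**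
(`χ` primitive mod `q ≠ 1`): `χ.RiemannHypothesis ↔ ∃ μ (measure on ℝ), ∀ g test,
Re W_χ(g ⋆ g̃) = ∫ ‖ĝ(½+it)‖² dμ(t)`.  (`→`: `ν_χ`; `←`: the integral of a nonnegative function is
`≥ 0`, so `WeilPositivityChar χ`, and Weil's criterion on `C_c^∞`, `weil_criterion_dirichlet_of_explicitFormula`
with `explicit_formula_dirichlet_holds`, gives `GRH(χ)`.)
[cite: Weil1952FormulesExplicites, the «lemme» p. 262] -/
theorem riemannHypothesis_iff_exists_measure_char (hq : q ≠ 1) (hprim : χ.IsPrimitive) :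
    χ.RiemannHypothesis ↔ ∃ μ : Measure ℝ, ∀ g : ℝ → ℂ, IsWeilTest g →
      (weilQuadraticChar χ g).re = ∫ t, ‖weilMellin g (1 / 2 + t * I)‖ ^ 2 ∂μ := by
  constructor
  · intro hGRH
    refine ⟨charZeroHeightMeasure χ, fun g hg ↦ ?_⟩
    rw [(weilQuadraticChar_eq_integral_of_riemannHypothesis hq hprim hGRH hg).2, Complex.ofReal_re]
  · rintro ⟨μ, hμ⟩
    refine (weil_criterion_dirichlet_of_explicitFormula explicit_formula_dirichlet_holds hq hprim).2
      fun g hg ↦ ?_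
    rw [hμ g hg]
    exact integral_nonneg fun t ↦ by positivity

end WeilBochner

end Literature.NumberTheory.LFunctions

end
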